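import Summits.Langlands.Langlands.Theorems.RamifiedCoefficientSeedAdjointLiftingGL3StubInertiaOrderTeichHelpers
import Literature.NumberTheory.GaloisRepresentations.FundamentalCharacterCyclotomicProofs
import Literature.NumberTheory.GaloisRepresentations.ModPGaloisRepCyclotomicProofs
import Literature.NumberTheory.GaloisRepresentations.ResidualRepOfTraceCongruence
import Literature.NumberTheory.GaloisRepresentations.GaloisRepUnramifiedProofs
import Literature.NumberTheory.GaloisRepresentations.TeichmullerCharacter
import Literature.NumberTheory.GaloisRepresentations.ModNCyclotomicCharacter
import Literature.NumberTheory.GaloisRepresentations.ResiduallyReducibleOfStableLine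
import Literature.NumberTheory.GaloisRepresentations.OrdinaryTwistedDeterminant
import HarnessLib

/-!
# Route `RamifiedCoefficientSeed`, crux `AdjointLiftingGL3` (stmt-Langlands-16779), line `birth`:
# stub `stub_inertiaOrderTeich` (S2b) — the Teichmüller twist and the registered stub

Second file of stub S2b of the checked skeleton `Cruxes/AdjointLiftingGL3/Lines/birth.lean`
(skeleton v5).  Part (a) (projective inertia order `> 5`) is `hasProjOrderGtFive_of_localShapeAt` of
the sibling file `…StubInertiaOrderTeichHelpers`; here part (b) and the assembly:

* §1 the reduction of the `p`-adic cyclotomic character `ε_p` of `Γ_ℚ` at `res σ`, `σ ∈ I_{ℚ_v}`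
  (`v ∋ p`), is the level-one fundamental character `ω(σ) = ψ₁(σ)` in `ℤ̄_p/𝔪`
  (`residue_eq_fundamentalCharacter_of_eq_cycPadicAlgCl`): `ψ₁ = χ̄_p` on `I_{ℚ_v}` (Serre 1972
  §1.8 Cor., `e = 1`), `χ̄_p(res σ) = χ̄_p(σ)`, `χ̄_p = ε_p mod p`, and any two ring maps
  `ℤ_p → ℤ̄_p/𝔪` agree (`ringHom_padicInt_ext`);
* §2 the continuous character `θ = η · ε_p : Γ_ℚ → ℚ̄_pˣ` (`exists_theta`), unit-valued
  (`norm_apply_eq_one_of_compactSpace`);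
* §3 `exists_teichTwistFor_of_localShapeAt`: the Teichmüller lift `μ` of `θ`
  (`exists_teichmullerCharacter`) has finite image (open kernel), satisfies `μ ≡ η ε_p (mod 𝔪)`, and
  is unramified at `v ∋ p` by local–global compatibility (`isUnramifiedAt_iff_toLocal_holds`):
  on `I_{ℚ_v}`, `η̄ = ω⁻¹` (clause (E) of `LocalShapeAt`) and `ε_p ≡ ω`, so `θ ≡ 1` and `μ = 1`;
* §4 the registered stub `stub_inertiaOrderTeich`.

References: Serre, Invent. Math. 15 (1972) §1.8; Serre, *Local Fields* II §4 Prop. 8 (Teichmüller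
representatives); Serre, *Abelian ℓ-adic representations* I §2.1.
-/

set_option linter.dupNamespace false -- `Summit.Langlands.Langlands` is the mandated namespace

noncomputable section

namespace Summit.Langlands.Langlands.Cruxes.AdjointLiftingGL3.Birth

open scoped MatrixGroups NumberField ValuativeRel
open NumberField IsDedekindDomain Field Filter
open Literature.NumberTheory.GaloisRepresentations Literature.NumberTheory.PAdicHodge
open Literature.NumberTheory.Automorphic
open Literature.NumberTheory.GaloisRepresentations.IsNonarchimedeanLocalField

/-! ## §1. The reduction of `ε_p` on the inertia at `p` is `ω` -/

section Cyclotomic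

variable (p : ℕ) [Fact p.Prime]

/-- **Two ring homomorphisms `ℤ_p → R` into a ring of characteristic `p` coincide**: both factor
through `ℤ_p/p = 𝔽_p` (`x = n + p y` with `n = x mod p ∈ ℕ`). [folklore] -/
theorem ringHom_padicInt_ext {R : Type*} [CommRing R] [CharP R p] (φ ψ : ℤ_[p] →+* R) : φ = ψ := by
  refine RingHom.ext fun x => ?_
  have hx : x - (x.zmodRepr : ℤ_[p]) ∈ Ideal.span {(p : ℤ_[p])} := by
    rw [← PadicInt.maximalIdeal_eq_span_p]; exact PadicInt.sub_zmodRepr_mem x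
  obtain ⟨y, hy⟩ := Ideal.mem_span_singleton'.mp hx
  have hx' : x = (x.zmodRepr : ℤ_[p]) + y * p := by rw [hy]; ring
  rw [hx', map_add, map_add, map_mul, map_mul, map_natCast, map_natCast, map_natCast, map_natCast,
    CharP.cast_eq_zero R p, mul_zero, mul_zero]

/-- **`χ̄_p(res σ) = χ̄_p(σ)`** for an extension `L/K` and `σ ∈ Γ_L` (both sides are pinned down by
the action on `μ_p(K̄)` and its image in `L̄`, `ι (res σ • ζ) = σ • ι ζ`).
Ref: Serre, *Abelian ℓ-adic representations* (1968), Ch. I §1.2. [folklore] -/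
theorem modPCyclotomicCharacterZMod_absGaloisRestrict' (K L : Type*) [Field K] [Field L]
    [Algebra K L] [NeZero (p : K)] [NeZero (p : L)] (σ : absoluteGaloisGroup L) :
    modPCyclotomicCharacterZMod K p (absGaloisRestrict K L σ) = modPCyclotomicCharacterZMod L p σ := by
  -- adapted from `modPCyclotomicCharacterZMod_absGaloisRestrict`
  -- (Literature/NumberTheory/EllipticCurves/OrdinaryReductionTorsionLineProofs.lean), not imported
  haveI : NeZero ((p : ℕ) : AlgebraicClosure K) :=
    NeZero.nat_of_injective (algebraMap K (AlgebraicClosure K)).injective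
  obtain ⟨ζ, hζ⟩ := HasEnoughRootsOfUnity.exists_primitiveRoot (AlgebraicClosure K) p
  have hζ' : IsPrimitiveRoot (absClosureEmbedding K L ζ) p :=
    hζ.map_of_injective (absClosureEmbedding K L).injective
  have h1 := modPCyclotomicCharacterZMod_spec K p (absGaloisRestrict K L σ) ζ hζ.pow_eq_one
  have h2 := modPCyclotomicCharacterZMod_spec L p σ (absClosureEmbedding K L ζ) hζ'.pow_eq_one
  have h3 := congrArg (absClosureEmbedding K L) h1
  rw [absGaloisRestrict_apply_smul, map_pow, h2] at h3
  have h4 := hζ'.pow_inj (ZMod.val_lt _) (ZMod.val_lt _) h3.symm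
  exact Units.ext (ZMod.val_injective _ h4)

/-- `ℤ_p ⊆ ℤ̄_p`: the image of `ℤ_p` in `ℚ̄_p` lies in the valuation ring. [folklore] -/
theorem algebraMap_padicInt_mem_padicAlgClIntegers (z : ℤ_[p]) :
    algebraMap ℤ_[p] (PadicAlgCl p) z ∈ padicAlgClIntegers p := by
  rw [padicAlgCl_mem_valuationSubring_iff, IsScalarTower.algebraMap_apply ℤ_[p] ℚ_[p] (PadicAlgCl p),
    PadicAlgCl.norm_extends]
  exact PadicInt.norm_le_one z

/-- **On the inertia at `p`, `ε_p` reduces to the fundamental character `ω`.**  For a place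
`v ∋ p` of `ℚ`, `σ` in the inertia group of `ℚ_v = v.adicCompletion ℚ`, any residue embedding `ιr`
and uniformiser `ϖ`: the reduction in `ℤ̄_p/𝔪` of `ε_p(res σ) ∈ ℤ_pˣ ⊆ ℚ̄_p` (`cycPadicAlgCl`) is
`ω(σ) = ψ₁(σ)`.  Chain: `ψ₁ = χ̄_p` on `I_{ℚ_v}` (Serre 1972 §1.8 Cor., `e = 1`:
`coe_fundamentalCharacter_one_eq_modPCyclotomicCharacter'`), `χ̄_p(res σ) = χ̄_p(σ)`, `χ̄_p = ε_p mod p`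
(`toZMod_cyclotomicCharacter_apply`), and `ℤ_p → ℤ̄_p → ℤ̄_p/𝔪` equals `ℤ_p → 𝔽_p → ℤ̄_p/𝔪`
(`ringHom_padicInt_ext`). [cite: SerreInventiones1972, §1.8 Prop. 8 and Cor.] -/
theorem residue_eq_fundamentalCharacter_of_eq_cycPadicAlgCl :
    ∀ {p : ℕ} [Fact p.Prime] {v : HeightOneSpectrum (𝓞 ℚ)}, ((p : ℕ) : 𝓞 ℚ) ∈ v.asIdeal →
      ∀ (ιr : absIntegers 𝒪[v.adicCompletion ℚ] (v.adicCompletion ℚ) ⧸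
            absMaximalIdeal (v.adicCompletion ℚ) →+* padicAlgClResidueField p)
        (ϖ : 𝒪[v.adicCompletion ℚ]) (hϖ : Irreducible ϖ) (σ : absInertia (v.adicCompletion ℚ))
        (x : padicAlgClIntegers p),
        (x : PadicAlgCl p) =
            cycPadicAlgCl p (absGaloisRestrict ℚ (v.adicCompletion ℚ) (σ : absoluteGaloisGroup _)) →
          IsLocalRing.residue (padicAlgClIntegers p) x =
            ((fundamentalCharacter (v.adicCompletion ℚ) 1 ιr ϖ hϖ σ : (padicAlgClResidueField p)ˣ) :
              padicAlgClResidueField p) := by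
  intro p _ v hv ιr ϖ hϖ σ x hx
  have hp : p.Prime := Fact.out
  have hirr : Irreducible ((p : ℕ) : 𝒪[v.adicCompletion ℚ]) :=
    irreducible_natCast_valuativeInteger_of_mem hp hv
  have hq : residueFieldCard (v.adicCompletion ℚ) = p := residueFieldCard_adicCompletion_eq_of_mem hp hv
  haveI : NeZero ((p : ℕ) : v.adicCompletion ℚ) := neZero_natCast_of_irreducible hirr
  haveI : CharP (padicAlgClResidueField p) p := charP_padicAlgClResidueField p
  letI : TopologicalSpace (padicAlgClResidueField p) := ⊥
  haveI : DiscreteTopology (padicAlgClResidueField p) := ⟨rfl⟩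
  haveI : IsTopologicalRing (padicAlgClResidueField p) :=
    { continuous_add := continuous_of_discreteTopology
      continuous_mul := continuous_of_discreteTopology
      continuous_neg := continuous_of_discreteTopology }
  set ι' : ZMod p →+* padicAlgClResidueField p := ZMod.castHom (dvd_refl p) _ with hι'
  rw [coe_fundamentalCharacter_one_eq_modPCyclotomicCharacter' hirr hq ιr ι' hϖ σ,
    coe_modPCyclotomicCharacter_apply,
    ← modPCyclotomicCharacterZMod_absGaloisRestrict' p ℚ (v.adicCompletion ℚ),
    ← toZMod_cyclotomicCharacter_apply ℚ p]
  set f : ℤ_[p] →+* padicAlgClResidueField p :=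
    (IsLocalRing.residue (padicAlgClIntegers p)).comp
      ((algebraMap ℤ_[p] (PadicAlgCl p)).codRestrict (padicAlgClIntegers p)
        (algebraMap_padicInt_mem_padicAlgClIntegers p)) with hf
  have hfx : f ((GaloisRep.cyclotomicCharacter ℚ p
      (absGaloisRestrict ℚ (v.adicCompletion ℚ) (σ : absoluteGaloisGroup _)) : ℤ_[p]ˣ) : ℤ_[p]) =
      IsLocalRing.residue (padicAlgClIntegers p) x := by
    rw [hf, RingHom.comp_apply]
    congr 1
    apply Subtype.ext
    rw [RingHom.codRestrict_apply, hx, cycPadicAlgCl, IsScalarTower.algebraMap_apply ℤ_[p] ℚ_[p] (PadicAlgCl p)]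
    rfl
  rw [← hfx, ringHom_padicInt_ext p f (ι'.comp PadicInt.toZMod), RingHom.comp_apply]

end Cyclotomic

/-! ## §2. The character `θ = η · ε_p` -/

section Theta

variable (p : ℕ) [Fact p.Prime]

/-- A continuous character of a compact group with values in `ℚ̄_pˣ` takes values of norm one
(the image of `‖χ‖` is a bounded subgroup of `ℝ_{>0}`). [folklore] -/
theorem norm_apply_eq_one_of_compactSpace {G : Type*} [Group G] [TopologicalSpace G]
    [CompactSpace G] (χ : G →ₜ* (PadicAlgCl p)ˣ) (g : G) :
    ‖((χ g : (PadicAlgCl p)ˣ) : PadicAlgCl p)‖ = 1 := by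
  -- adapted from `norm_unitsChar_eq_one` (Literature/NumberTheory/GaloisRepresentations/TriangulineVariety.lean)
  have hχ : Continuous fun g => ((χ g : (PadicAlgCl p)ˣ) : PadicAlgCl p) :=
    Units.continuous_val.comp χ.continuous
  obtain ⟨C, hC⟩ := (isCompact_range hχ.norm).bddAbove
  have hle : ∀ g : G, ‖((χ g : (PadicAlgCl p)ˣ) : PadicAlgCl p)‖ ≤ 1 := fun g => not_lt.mp fun hlt => by
    obtain ⟨m, hm⟩ := pow_unbounded_of_one_lt C hlt
    have hm' : ‖((χ g : (PadicAlgCl p)ˣ) : PadicAlgCl p)‖ ^ m ≤ C := by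
      have := hC (Set.mem_range_self (g ^ m))
      simpa only [map_pow, Units.val_pow_eq_pow_val, norm_pow] using this
    exact absurd hm' (not_le.mpr hm)
  refine le_antisymm (hle g) ?_
  have h1 := hle g⁻¹
  rw [map_inv, Units.val_inv_eq_inv_val, norm_inv] at h1
  exact (inv_le_one₀ (norm_pos_iff.mpr (Units.ne_zero _))).mp h1

/-- **The continuous character `θ = η · ε_p : Γ_ℚ → ℚ̄_pˣ`** whose Teichmüller lift is the twist
`μ`: `θ(σ) = η(σ)₀₀ · ε_p(σ)` (`det` of the rank-one `η` times the `p`-adic cyclotomic character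
pushed into `ℚ̄_p`). [folklore] -/
theorem exists_theta (η : FramedGaloisRep ℚ (PadicAlgCl p) 1) :
    ∃ θ : absoluteGaloisGroup ℚ →ₜ* (PadicAlgCl p)ˣ,
      ∀ σ, ((θ σ : (PadicAlgCl p)ˣ) : PadicAlgCl p) = (η σ).val 0 0 * cycPadicAlgCl p σ := by
  set cyc : absoluteGaloisGroup ℚ →ₜ* (PadicAlgCl p)ˣ :=
    ContinuousMonoidHom.comp
      ⟨Units.map (algebraMap ℤ_[p] (PadicAlgCl p) : ℤ_[p] →* PadicAlgCl p),
        Continuous.units_map _ (continuous_algebraMap_padicInt_padicAlgCl p)⟩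
      (GaloisRep.cyclotomicCharacter ℚ p) with hcyc
  refine ⟨{ toFun := fun σ => FramedRep.det η σ * cyc σ
            map_one' := by simp
            map_mul' := fun a b => by simp only [map_mul]; exact mul_mul_mul_comm _ _ _ _
            continuous_toFun := (FramedRep.det η).continuous.mul cyc.continuous }, fun σ => ?_⟩
  change (((FramedRep.det η σ * cyc σ : (PadicAlgCl p)ˣ)) : PadicAlgCl p) = _
  rw [Units.val_mul, FramedRep.det_apply, Matrix.GeneralLinearGroup.val_det_apply, Matrix.det_fin_one]
  rfl

/-- `ε_p(σ) ∈ ℤ̄_p` (it lies in `ℤ_pˣ`). [folklore] -/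
theorem cycPadicAlgCl_mem (σ : absoluteGaloisGroup ℚ) : cycPadicAlgCl p σ ∈ padicAlgClIntegers p := by
  rw [padicAlgCl_mem_valuationSubring_iff]
  change ‖algebraMap ℚ_[p] (PadicAlgCl p) _‖ ≤ 1
  rw [PadicAlgCl.norm_extends]
  exact PadicInt.norm_le_one _

/-- Two elements of `ℤ̄_p` with the same residue are at distance `< 1`. [folklore] -/
theorem norm_sub_lt_one_of_residue_eq' {x y : padicAlgClIntegers p}
    (h : IsLocalRing.residue (padicAlgClIntegers p) x = IsLocalRing.residue (padicAlgClIntegers p) y) :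
    ‖(x : PadicAlgCl p) - y‖ < 1 := by
  rw [← sub_eq_zero, ← map_sub, IsLocalRing.residue_eq_zero_iff,
    mem_maximalIdeal_iff_norm_lt_one (padicAlgCl_mem_valuationSubring_iff p)] at h
  exact h

end Theta

/-! ## §3. Consequence (b) of the local shape: the Teichmüller twist -/

section PartB

variable {p : ℕ} [Fact p.Prime]

/-- **(b) The Teichmüller twist `μ ≡ η · ε_p`.**  Let `θ = η · ε_p : Γ_ℚ → ℤ̄_pˣ` and `μ` its
Teichmüller lift (`exists_teichmullerCharacter`: finite order prime to `p`, `μ ≡ θ (mod 𝔪)`, open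
kernel `{‖θ − 1‖ < 1}`).  Then `μ` has finite image, `μ(σ) ≡ η(σ) ε_p(σ)`, and `μ` is UNRAMIFIED at
`v ∋ p`: by local–global compatibility (`isUnramifiedAt_iff_toLocal_holds`) it suffices that
`θ(res σ) ≡ 1` for `σ ∈ I_{ℚ_v}`, and indeed `η̄(res σ) = ω(σ)⁻¹` (clause (E) of `LocalShapeAt`)
while `ε_p(res σ) ≡ ω(σ)` (`residue_eq_fundamentalCharacter_of_eq_cycPadicAlgCl`).
[cite: SerreLocalFields1979, Ch. II §4, Prop. 8] -/
theorem exists_teichTwistFor_of_localShapeAt {ρ₀ : FramedGaloisRep ℚ (PadicAlgCl p) 2}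
    {η : FramedGaloisRep ℚ (PadicAlgCl p) 1} (hshape : LocalShapeAt p ρ₀ η) :
    ∃ μ : FramedGaloisRep ℚ (PadicAlgCl p) 1, TeichTwistFor p η μ := by
  have hpr : p.Prime := Fact.out
  obtain ⟨θ, hθ⟩ := exists_theta p η
  obtain ⟨n, θ', -, -, -, hcong, hker, hopen⟩ :=
    exists_teichmullerCharacter θ (norm_apply_eq_one_of_compactSpace p θ)
  set θc : absoluteGaloisGroup ℚ →ₜ* (PadicAlgCl p)ˣ :=
    ⟨θ', Literature.NumberTheory.GaloisRepresentations.MonoidHom.continuous_of_isOpen_ker θ' hopen⟩ with hθc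
  have hθc_apply : ∀ g, θc g = θ' g := fun g => rfl
  set μ : FramedGaloisRep ℚ (PadicAlgCl p) 1 := FramedRep.ofCharacter θc with hμ
  have hμ_apply : ∀ g, ((μ g : GL (Fin 1) (PadicAlgCl p)) : Matrix (Fin 1) (Fin 1) (PadicAlgCl p)) 0 0 =
      ((θ' g : (PadicAlgCl p)ˣ) : PadicAlgCl p) := fun g => by
    rw [hμ, FramedRep.ofCharacter_apply_coe, hθc_apply]
  have hone : ∀ g, μ g = 1 ↔ θ' g = 1 := fun g => by
    constructor
    · intro h
      have h' := hμ_apply g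
      rw [h, Units.val_one, Matrix.one_apply_eq] at h'
      exact Units.ext h'.symm
    · intro h
      rw [hμ]
      change FramedRep.unitsContinuousMulEquivOfUnique (Fin 1) (PadicAlgCl p) (θc g) = 1
      rw [hθc_apply, h, map_one]
  refine ⟨μ, ?_, ?_, ?_⟩
  · -- finite image: the kernel is open in the compact `Γ_ℚ`
    have hkerμ : (((μ : absoluteGaloisGroup ℚ →* GL (Fin 1) (PadicAlgCl p)).ker :
        Subgroup (absoluteGaloisGroup ℚ)) : Set (absoluteGaloisGroup ℚ)) = (θ'.ker : Set _) := by
      ext g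
      simp only [SetLike.mem_coe, MonoidHom.mem_ker]
      exact hone g
    have hopenμ : IsOpen (((μ : absoluteGaloisGroup ℚ →* GL (Fin 1) (PadicAlgCl p)).ker :
        Subgroup (absoluteGaloisGroup ℚ)) : Set (absoluteGaloisGroup ℚ)) := by
      rw [hkerμ]; exact hopen
    haveI : Finite (absoluteGaloisGroup ℚ ⧸ (μ : absoluteGaloisGroup ℚ →* GL (Fin 1) (PadicAlgCl p)).ker) :=
      Subgroup.quotient_finite_of_isOpen _ hopenμ
    haveI : Finite (μ : absoluteGaloisGroup ℚ →* GL (Fin 1) (PadicAlgCl p)).range :=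
      Finite.of_equiv _ (QuotientGroup.quotientKerEquivRange _).toEquiv
    have hrange : Set.range μ =
        (((μ : absoluteGaloisGroup ℚ →* GL (Fin 1) (PadicAlgCl p)).range :
          Subgroup (GL (Fin 1) (PadicAlgCl p))) : Set (GL (Fin 1) (PadicAlgCl p))) :=
      (MonoidHom.coe_range _).symm
    rw [hrange]
    exact Set.toFinite _
  · -- unramified at `v ∋ p`
    intro v hv
    haveI : IsAlgClosed (padicAlgClResidueField p) :=
      Literature.RingTheory.Valuation.isAlgClosed_residueField (padicAlgClIntegers p)
    haveI : CharP (padicAlgClResidueField p) p := charP_padicAlgClResidueField p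
    have hq := residueFieldCard_adicCompletion_eq_of_mem hpr hv
    have hirr := irreducible_natCast_valuativeInteger_of_mem hpr hv
    obtain ⟨ιr⟩ := nonempty_ringHom_residue (k := padicAlgClResidueField p) p (v.adicCompletion ℚ) hq
    obtain ⟨τ₀, hτ₀⟩ := FramedGaloisRep.exists_isResidualRepOf_fin_two ρ₀
    obtain ⟨ηb, x, hηb, hx, hηbx⟩ := exists_isReductionOf_rank_one p η
    have hE := (hshape v hv τ₀ ηb hτ₀ hηb ιr _ hirr).1
    rw [← FramedGaloisRep.isUnramifiedAt_toGaloisRep_iff]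
    refine (GaloisRep.isUnramifiedAt_iff_toLocal_holds v _).mpr fun τ hτ => ?_
    rw [GaloisRep.toLocal_apply]
    have h1 : μ (absGaloisRestrict ℚ (v.adicCompletion ℚ) τ) = 1 := by
      rw [hone, hker, hθ]
      -- `‖η(res τ)₀₀ ε_p(res τ) - 1‖ < 1`: both factors are integral with inverse residues
      set g := absGaloisRestrict ℚ (v.adicCompletion ℚ) τ with hg
      have hy := cycPadicAlgCl_mem p g
      have hres_y := residue_eq_fundamentalCharacter_of_eq_cycPadicAlgCl hv ιr _ hirr ⟨τ, hτ⟩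
        ⟨cycPadicAlgCl p g, hy⟩ rfl
      have hres_x : IsLocalRing.residue (padicAlgClIntegers p) (x g) =
          (((fundamentalCharacter (v.adicCompletion ℚ) 1 ιr _ hirr ⟨τ, hτ⟩)⁻¹ :
            (padicAlgClResidueField p)ˣ) : padicAlgClResidueField p) := by
        rw [← hηbx g]
        exact hE ⟨τ, hτ⟩
      have hprod : IsLocalRing.residue (padicAlgClIntegers p) (x g * ⟨cycPadicAlgCl p g, hy⟩) =
          IsLocalRing.residue (padicAlgClIntegers p) 1 := by
        rw [map_mul, map_one, hres_x, hres_y, Units.inv_mul]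
      have := norm_sub_lt_one_of_residue_eq' p hprod
      rw [← hx g]
      simpa using this
    change FramedRep.toRepresentation μ _ = 1
    refine LinearMap.ext fun w => ?_
    simp [h1]
  · -- the congruence `μ ≡ η ε_p`
    intro σ
    rw [hμ_apply, ← hθ]
    exact hcong σ

end PartB

/-! ## §4. The registered stub -/

/-- **Stub `stub_inertiaOrderTeich` (S2b) of the line `birth`**: for `p ≥ 11`, the local shape at
`p` of the seed (`LocalShapeAt`, Fontaine–Laffaille, stub S2a) yields (a) an element of projective
order `> 5` in the image of every residual `τ₀` of `ρ₀` (inertia at `p` has projective order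
`p − 1` or `p + 1 ≥ 10`), the input of Dickson's theorem, and (b) the Teichmüller twist
`μ ≡ η ε_p (mod 𝔪)`, of finite order and unramified at `p` (the lift of `η̄ ω`, unramified at `p`
since `η̄|_{I_p} = ω⁻¹`). [cite: Serre1987, §2.1–2.2] [cite: SerreLocalFields1979, Ch. II §4, Prop. 8] -/
theorem stub_inertiaOrderTeich :
    ∀ (p : ℕ) [Fact p.Prime], 11 ≤ p →
      ∀ (ρ₀ : FramedGaloisRep ℚ (PadicAlgCl p) 2) (η : FramedGaloisRep ℚ (PadicAlgCl p) 1),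
        LocalShapeAt p ρ₀ η →
          (∀ τ₀ : absoluteGaloisGroup ℚ →* GL (Fin 2) (padicAlgClResidueField p),
              ρ₀.IsResidualRepOf (RingHom.id _) τ₀ → HasProjOrderGtFive τ₀) ∧
            ∃ μ : FramedGaloisRep ℚ (PadicAlgCl p) 1, TeichTwistFor p η μ := by
  intro p _ hp ρ₀ η hshape
  exact ⟨fun τ₀ hτ₀ => hasProjOrderGtFive_of_localShapeAt hp hshape τ₀ hτ₀,
    exists_teichTwistFor_of_localShapeAt hshape⟩

end Summit.Langlands.Langlands.Cruxes.AdjointLiftingGL3.Birth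

end
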